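import Literature.Topology.PlanarFoliations.PatternCount
import Literature.Topology.PlanarFoliations.LeafJordan
import Literature.Topology.PlanarFoliations.BandOpen
import HarnessLib

/-!
# Essential pattern cycles in the disc of a compact leaf; count-minimisers; terminal polygons

Topic: Topology / PlanarFoliations, sequel to `PatternCount.lean`, `LeafJordan.lean`,
`PlaneTopology/JordanFill.lean`. Fix star data `D`, an open embedding `ι`, a bi-orientation, and a
compact leaf `K₀ = F.leaf x₀` whose disc lies in the region. The **essential pattern cycles** in
the disc of `K₀` are

* `CompactPattern`: compact leaves `K` with `discLeaf K ⊆ discLeaf K₀` whose image under the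
  foliated map is not null (`¬ ImageNull`);
* `PolyPattern`: simple separatrix polygons `Z` in `discLeaf K₀` (`PolyCycle`) whose leaf loop is
  not null-homotopic.

Their fills (`discLeaf K`, `Z.fill`) lie in `discLeaf K₀` (`PolyPattern.fill_subset`); their counts
are positive. The **minimal count** `minCount` over all essential patterns exists (the disc of `K₀`
is a pattern when `K₀` is essential). **A polygon of minimal count is terminal**
(`PolyPattern.fill_eq_of_fill_subset`, `discLeaf_eq`-type statements): no essential pattern has
its fill strictly inside — a point of the polygon off the smaller fill is a puncture or lies on a
separatrix leaf of the polygon, either of which is counted by the polygon and not by the smaller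
pattern (`count_lt_of_not_subset`).

## References

* C. Camacho, A. Lins Neto, *Geometric Theory of Foliations*, Birkhäuser (1985), Ch. VII §2
  [CamachoLinsNeto1985].
-/

noncomputable section

open Set Filter Function Metric unitInterval
open _root_.Topology
open Literature.Topology.FourManifolds Literature.Topology.FourManifolds.Foliation Literature.Topology.PlaneTopology

namespace Literature.Topology.PlanarFoliations

variable {X : Type*} [TopologicalSpace X] [T2Space X] [SecondCountableTopology X] [Nonempty X] {F : Foliation ℝ X} {ι : X → ℂ}
variable {B : Type*} [NormedAddCommGroup B] {M : Type*} [TopologicalSpace M] {T : Foliation B M} {g : ℂ → M}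

namespace StarData

/-! ## Points of a polygon: punctures or separatrix points -/

namespace PolyCycle

variable {D : StarData F ι T g} {hbi : IsBiOriented F} {C : Set ℂ} (Z : D.PolyCycle hbi C) (hι : IsOpenEmbedding ι) (hC : IsCompact C)

/-- **A point of the polygon is a puncture of it or a point of one of its separatrix leaves.**
[folklore] -/
theorem mem_range_loop_cases {z : ℂ} (hz : z ∈ range (Z.loop hι hC)) :
    (∃ i, z = Z.vtx i) ∨ ∃ i, z ∈ ι '' F.leaf (Z.sx i) := by
  rw [loop, range_polyLoop] at hz
  obtain ⟨θ, rfl⟩ := hz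
  rcases D.polyTrace_cases hι hC Z.hv Z.hmem Z.omega Z.alpha (Z.m - 1) θ with h0 | ⟨j, -, h | h⟩
  · left; exact ⟨idx Z.m 0, by rw [h0, polyTrace_zero_apply]⟩
  · right; exact ⟨_, h⟩
  · left; exact ⟨_, h⟩

/-- **The curve of a polygon lies in the compact set of its separatrices** (links and prong arcs
are leaf points, punctures are limits of tail points). [folklore] -/
theorem range_loop_subset : range (Z.loop hι hC) ⊆ C := by
  intro z hz
  rcases Z.mem_range_loop_cases hι hC hz with ⟨i, rfl⟩ | ⟨i, y, hy, rfl⟩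
  · -- a puncture: limit of points of the forward tail of `sx i`, which are in the closed `C`
    have hω : Z.vtx i ∈ omegaSet hbi ι (Z.sx i) := by rw [Z.omega i]; exact mem_singleton _
    have hcl : Z.vtx i ∈ closure ((fun q : F.Leaf (Z.sx i) ↦ ι (Leaf.pt q)) '' fwd hbi (Leaf.base F (Z.sx i))) :=
      (mem_omegaSet_iff.1 hω) _
    refine hC.isClosed.closure_subset (closure_mono ?_ hcl)
    rintro _ ⟨q, -, rfl⟩
    exact Z.hmem i q
  · exact Z.hmem i (Leaf.mk y hy)

/-- The fill of a polygon in the fill of a Jordan loop lies in that fill. [folklore] -/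
theorem fill_subset_fill {A : ℝ → ℂ} (hA : IsJordanLoop A) (h : C ⊆ IsJordanLoop.fill A) : Z.fill hι hC ⊆ IsJordanLoop.fill A :=
  hA.fill_subset_fill_of_range_subset_fill ((Z.range_loop_subset hι hC).trans h)

/-- The fill of the polygon is the fill of its Jordan loop. [folklore] -/
theorem fill_eq : Z.fill hι hC = IsJordanLoop.fill (Z.loop hι hC) := rfl

/-- **The count drops off a polygon**: a plane set `A` inside the fill of the polygon which misses
a point of the polygon has smaller count. [folklore] -/
theorem count_lt_of_not_subset {A : Set ℂ} (hA : A ⊆ Z.fill hι hC) (hnot : ¬ range (Z.loop hι hC) ⊆ A) :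
    D.count A < D.count (Z.fill hι hC) := by
  obtain ⟨z, hz, hzA⟩ := not_subset.1 hnot
  have hfinL := D.finite_counted (Z.fill hι hC)
  have hfinP : (D.P ∩ Z.fill hι hC).Finite := D.P_finite.subset inter_subset_left
  have hsubL : {L ∈ D.sepLeaves | ι '' L ⊆ A} ⊆ {L ∈ D.sepLeaves | ι '' L ⊆ Z.fill hι hC} := fun _ hL ↦ ⟨hL.1, hL.2.trans hA⟩
  have hsubP : D.P ∩ A ⊆ D.P ∩ Z.fill hι hC := inter_subset_inter_right _ hA
  rcases Z.mem_range_loop_cases hι hC hz with ⟨i, rfl⟩ | ⟨i, hzi⟩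
  · -- a puncture of the polygon off `A`: the puncture term drops
    have hlt : (D.P ∩ A).ncard < (D.P ∩ Z.fill hι hC).ncard :=
      ncard_lt_ncard (ssubset_iff_subset_ne.2 ⟨hsubP, fun he ↦ hzA (he.symm ▸ ⟨Z.hv i, Z.vtx_mem_fill hι hC i⟩ : Z.vtx i ∈ D.P ∩ A).2⟩) hfinP
    exact add_lt_add_of_le_of_lt (ncard_le_ncard hsubL hfinL) hlt
  · -- a point of a separatrix leaf of the polygon off `A`: that leaf drops
    have hmem : F.leaf (Z.sx i) ∈ {L ∈ D.sepLeaves | ι '' L ⊆ Z.fill hι hC} := ⟨Z.leaf_mem_sepLeaves hC i, Z.image_leaf_subset_fill hι hC i⟩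
    have hnmem : F.leaf (Z.sx i) ∉ {L ∈ D.sepLeaves | ι '' L ⊆ A} := fun h ↦ hzA (h.2 hzi)
    have hlt : {L ∈ D.sepLeaves | ι '' L ⊆ A}.ncard < {L ∈ D.sepLeaves | ι '' L ⊆ Z.fill hι hC}.ncard :=
      ncard_lt_ncard (ssubset_iff_subset_ne.2 ⟨hsubL, fun he ↦ hnmem (he.symm ▸ hmem)⟩) hfinL
    exact add_lt_add_of_lt_of_le hlt (ncard_le_ncard hsubP hfinP)

/-- **A Jordan fill inside the polygon's fill with count at least the polygon's is the whole
fill** (the minimality step of terminality). [folklore] -/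
theorem fill_eq_of_count_le {A : ℝ → ℂ} (hA : IsJordanLoop A) (hsub : IsJordanLoop.fill A ⊆ Z.fill hι hC)
    (hle : D.count (Z.fill hι hC) ≤ D.count (IsJordanLoop.fill A)) : IsJordanLoop.fill A = Z.fill hι hC := by
  have hrange : range (Z.loop hι hC) ⊆ IsJordanLoop.fill A := by
    by_contra hnot
    exact absurd (Z.count_lt_of_not_subset hι hC hsub hnot) (not_lt.2 hle)
  exact hsub.antisymm (hA.fill_subset_fill_of_range_subset_fill hrange)

end PolyCycle

/-! ## Essential patterns in the disc of a compact leaf -/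

section Patterns

variable (D : StarData F ι T g) (hbi : IsBiOriented F) (hι : IsOpenEmbedding ι) (x₀ : X)

/-- **An essential compact pattern** in the disc of the leaf of `x₀`: a compact leaf whose disc lies
in that disc and whose image under the foliated map is not null. [folklore] -/
structure CompactPattern where
  /-- a point of the compact leaf -/
  y : X
  compact : IsCompact (F.leaf y)
  sub : discLeaf F ι y ⊆ discLeaf F ι x₀
  ess : ¬ ImageNull D.foliated y

/-- **An essential polygon pattern** in the disc of the leaf of `x₀`: a simple separatrix polygon in
that disc whose leaf loop is not null-homotopic. [folklore] -/
structure PolyPattern (hC₀ : IsCompact (discLeaf F ι x₀)) where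
  /-- the polygon -/
  Z : D.PolyCycle hbi (discLeaf F ι x₀)
  ess : ¬ (Z.leafLoop hι hC₀).Homotopic (Path.refl _)

variable {D hbi hι x₀}

/-- **The fill of a polygon pattern lies in the ambient disc.** [folklore] -/
theorem PolyPattern.fill_subset (hK₀ : IsCompact (F.leaf x₀)) {hC₀ : IsCompact (discLeaf F ι x₀)} (P : D.PolyPattern hbi hι x₀ hC₀) :
    P.Z.fill hι hC₀ ⊆ discLeaf F ι x₀ :=
  fill_subset_discLeaf_of_range_subset_discLeaf hbi hι hK₀ (P.Z.range_loop_subset hι hC₀)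

/-- The count of a compact pattern. [folklore] -/
def CompactPattern.val (K : D.CompactPattern x₀) : ℕ := D.count (discLeaf F ι K.y)

/-- The count of a polygon pattern. [folklore] -/
def PolyPattern.val {hC₀ : IsCompact (discLeaf F ι x₀)} (P : D.PolyPattern hbi hι x₀ hC₀) : ℕ := D.count (P.Z.fill hι hC₀)

/-- The ambient essential compact leaf as a compact pattern. [folklore] -/
def CompactPattern.top (hK₀ : IsCompact (F.leaf x₀)) (hess : ¬ ImageNull D.foliated x₀) : D.CompactPattern x₀ := ⟨x₀, hK₀, Subset.rfl, hess⟩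

variable (D hbi hι x₀) in
/-- The set of counts of essential patterns. [folklore] -/
def patternVals (hC₀ : IsCompact (discLeaf F ι x₀)) : Set ℕ :=
  range (fun K : D.CompactPattern x₀ ↦ K.val) ∪ range (fun P : D.PolyPattern hbi hι x₀ hC₀ ↦ P.val)

variable (D hbi hι x₀) in
/-- **The minimal count** of an essential pattern in the disc. [folklore] -/
def minCount (hC₀ : IsCompact (discLeaf F ι x₀)) : ℕ := sInf (patternVals D hbi hι x₀ hC₀)

variable {hC₀ : IsCompact (discLeaf F ι x₀)}

/-- The set of counts is nonempty when the ambient leaf is essential. [folklore] -/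
theorem patternVals_nonempty (hK₀ : IsCompact (F.leaf x₀)) (hess : ¬ ImageNull D.foliated x₀) : (patternVals D hbi hι x₀ hC₀).Nonempty :=
  ⟨_, Or.inl ⟨CompactPattern.top hK₀ hess, rfl⟩⟩

/-- The minimal count is attained. [folklore] -/
theorem minCount_mem (hK₀ : IsCompact (F.leaf x₀)) (hess : ¬ ImageNull D.foliated x₀) :
    minCount D hbi hι x₀ hC₀ ∈ patternVals D hbi hι x₀ hC₀ := Nat.sInf_mem (patternVals_nonempty hK₀ hess)

/-- Every compact pattern has count at least the minimal count. [folklore] -/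
theorem minCount_le_val (K : D.CompactPattern x₀) : minCount D hbi hι x₀ hC₀ ≤ K.val := Nat.sInf_le (Or.inl ⟨K, rfl⟩)

/-- Every polygon pattern has count at least the minimal count. [folklore] -/
theorem minCount_le_pval (P : D.PolyPattern hbi hι x₀ hC₀) : minCount D hbi hι x₀ hC₀ ≤ P.val := Nat.sInf_le (Or.inr ⟨P, rfl⟩)

/-! ## A polygon of minimal count is terminal -/

/-- **Terminality of a minimal polygon against polygon patterns**: a polygon pattern whose fill is
in the fill of a polygon pattern of minimal count has the same fill. [folklore] -/
theorem PolyPattern.fill_eq_of_fill_subset (P Q : D.PolyPattern hbi hι x₀ hC₀) (hmin : P.val = minCount D hbi hι x₀ hC₀)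
    (hsub : Q.Z.fill hι hC₀ ⊆ P.Z.fill hι hC₀) : Q.Z.fill hι hC₀ = P.Z.fill hι hC₀ :=
  P.Z.fill_eq_of_count_le hι hC₀ (Q.Z.isJordanLoop_loop hι hC₀) hsub (by rw [← PolyPattern.val, hmin]; exact minCount_le_pval Q)

/-- **Terminality of a minimal polygon against compact patterns**: a compact pattern whose disc is
in the fill of a polygon pattern of minimal count has that fill as its disc. [folklore] -/
theorem PolyPattern.discLeaf_eq_of_subset (P : D.PolyPattern hbi hι x₀ hC₀) (K : D.CompactPattern x₀) (hmin : P.val = minCount D hbi hι x₀ hC₀)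
    (hsub : discLeaf F ι K.y ⊆ P.Z.fill hι hC₀) : discLeaf F ι K.y = P.Z.fill hι hC₀ := by
  obtain ⟨γ, hJ, -, -, hfill⟩ := exists_isJordanLoop_leaf hbi hι K.compact
  have hle : D.count (P.Z.fill hι hC₀) ≤ D.count (IsJordanLoop.fill γ) := by
    rw [hfill, ← PolyPattern.val, hmin]
    exact minCount_le_val (hbi := hbi) (hι := hι) (hC₀ := hC₀) K
  rw [← hfill] at hsub ⊢
  exact P.Z.fill_eq_of_count_le hι hC₀ hJ hsub hle

end Patterns

/-! ## Disjoint sets count disjointly; discs of compact leaves are nested or disjoint -/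

section Chain

variable (D : StarData F ι T g)

omit [T2Space X] [SecondCountableTopology X] [Nonempty X] in
/-- **Disjoint sets count at least the sum** (a counted leaf or puncture of one is not counted by
the other). [folklore] -/
theorem count_add_count_le_of_disjoint {A A' : Set ℂ} (h : Disjoint A A') (hA : ∀ L ∈ D.sepLeaves, ι '' L ⊆ A → (ι '' L).Nonempty) :
    D.count A + D.count A' ≤ D.count (A ∪ A') := by
  have hfin := D.finite_counted (A ∪ A')
  have hfinP : (D.P ∩ (A ∪ A')).Finite := D.P_finite.subset inter_subset_left
  -- leaves
  have hL : {L ∈ D.sepLeaves | ι '' L ⊆ A}.ncard + {L ∈ D.sepLeaves | ι '' L ⊆ A'}.ncard ≤ {L ∈ D.sepLeaves | ι '' L ⊆ A ∪ A'}.ncard := by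
    rw [← ncard_union_eq ?_ (D.finite_counted A) (D.finite_counted A')]
    · exact ncard_le_ncard (union_subset (fun L hL ↦ ⟨hL.1, hL.2.trans subset_union_left⟩)
        (fun L hL ↦ ⟨hL.1, hL.2.trans subset_union_right⟩)) hfin
    · refine disjoint_left.2 fun L hL hL' ↦ ?_
      obtain ⟨z, hz⟩ := hA L hL.1 hL.2
      exact disjoint_left.1 h (hL.2 hz) (hL'.2 hz)
  -- punctures
  have hP : (D.P ∩ A).ncard + (D.P ∩ A').ncard ≤ (D.P ∩ (A ∪ A')).ncard := by
    rw [← ncard_union_eq (h.mono inter_subset_right inter_subset_right) (D.P_finite.subset inter_subset_left)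
      (D.P_finite.subset inter_subset_left), ← inter_union_distrib_left]
  calc D.count A + D.count A' = ({L ∈ D.sepLeaves | ι '' L ⊆ A}.ncard + {L ∈ D.sepLeaves | ι '' L ⊆ A'}.ncard) +
        ((D.P ∩ A).ncard + (D.P ∩ A').ncard) := by unfold count; ring
    _ ≤ _ := add_le_add hL hP

omit [T2Space X] [SecondCountableTopology X] [Nonempty X] in
/-- The separatrix leaves are nonempty, so are their images. [folklore] -/
theorem image_nonempty_of_mem_sepLeaves {L : Set X} (hL : L ∈ D.sepLeaves) : (ι '' L).Nonempty := by
  obtain ⟨s, -, rfl⟩ := hL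
  exact ⟨ι s, s, F.mem_leaf_self s, rfl⟩

variable {D}

omit [Nonempty X] in
/-- **The discs of two compact leaves are nested or disjoint.** [folklore] -/
theorem discLeaf_trichotomy (hbi : IsBiOriented F) (hι : IsOpenEmbedding ι) {y w : X} (hK : IsCompact (F.leaf y)) (hK' : IsCompact (F.leaf w)) :
    discLeaf F ι y ⊆ discLeaf F ι w ∨ discLeaf F ι w ⊆ discLeaf F ι y ∨ Disjoint (discLeaf F ι y) (discLeaf F ι w) := by
  by_cases hyw : F.leaf y = F.leaf w
  · left; unfold discLeaf insideLeaf; rw [hyw]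
  obtain ⟨A, hA, hrA, hinA, hfillA⟩ := exists_isJordanLoop_leaf hbi hι hK
  obtain ⟨C, hC, hrC, hinC, hfillC⟩ := exists_isJordanLoop_leaf hbi hι hK'
  have hdisj : Disjoint (range A) (range C) := by
    rw [hrA, hrC, disjoint_left]
    rintro _ ⟨a, ha, rfl⟩ ⟨c, hc, hac⟩
    have : c = a := hι.injective hac
    subst this
    exact hyw ((leaf_eq_of_mem ha).symm.trans (leaf_eq_of_mem hc))
  rw [← hfillA, ← hfillC]
  rcases IsJordanLoop.trichotomy hA hC hdisj with h | h | ⟨h1, h2⟩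
  · left
    exact hC.fill_subset_fill_of_range_subset_fill (h.trans subset_union_right)
  · right; left
    exact hA.fill_subset_fill_of_range_subset_fill (h.trans subset_union_right)
  · right; right
    have hii : Disjoint (IsJordanLoop.inside A) (IsJordanLoop.inside C) := IsJordanLoop.disjoint_inside_inside hA hC h1 h2
    simp only [IsJordanLoop.fill, disjoint_union_left, disjoint_union_right]
    refine ⟨⟨hdisj, disjoint_left.2 fun z (hz : z ∈ IsJordanLoop.inside A) (hz' : z ∈ range C) ↦ ?_⟩,
      ⟨disjoint_left.2 fun z (hz : z ∈ range A) (hz' : z ∈ IsJordanLoop.inside C) ↦ ?_, hii⟩⟩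
    · exact disjoint_left.1 IsJordanLoop.disjoint_inside_outside hz (h2 hz')
    · exact disjoint_left.1 IsJordanLoop.disjoint_inside_outside hz' (h1 hz)

/-! ## Compact minimisers form a chain -/

variable {hbi : IsBiOriented F} {hι : IsOpenEmbedding ι} {x₀ : X} {hC₀ : IsCompact (discLeaf F ι x₀)}

/-- **Inside a minimiser every compact pattern is a minimiser** (monotonicity of the count).
[folklore] -/
theorem CompactPattern.val_eq_of_sub {A : Set ℂ} (hA : D.count A = minCount D hbi hι x₀ hC₀) (K : D.CompactPattern x₀)
    (hsub : discLeaf F ι K.y ⊆ A) : K.val = minCount D hbi hι x₀ hC₀ :=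
  le_antisymm (by rw [← hA]; exact D.count_mono hsub) (minCount_le_val (hbi := hbi) (hι := hι) (hC₀ := hC₀) K)

/-- **Inside a minimiser every polygon pattern is a minimiser.** [folklore] -/
theorem PolyPattern.val_eq_of_sub {A : Set ℂ} (hA : D.count A = minCount D hbi hι x₀ hC₀) (P : D.PolyPattern hbi hι x₀ hC₀)
    (hsub : P.Z.fill hι hC₀ ⊆ A) : P.val = minCount D hbi hι x₀ hC₀ :=
  le_antisymm (by rw [← hA]; exact D.count_mono hsub) (minCount_le_pval P)

/-- **Two compact minimisers inside a minimiser have nested discs** (disjoint discs would count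
twice the minimum, which is positive). [folklore] -/
theorem CompactPattern.nested_of_minimisers (hΩ : discLeaf F ι x₀ ⊆ D.Ω) {A : Set ℂ} (hA : D.count A = minCount D hbi hι x₀ hC₀)
    (K K' : D.CompactPattern x₀) (hK : discLeaf F ι K.y ⊆ A) (hK' : discLeaf F ι K'.y ⊆ A) :
    discLeaf F ι K.y ⊆ discLeaf F ι K'.y ∨ discLeaf F ι K'.y ⊆ discLeaf F ι K.y := by
  rcases discLeaf_trichotomy hbi hι K.compact K'.compact with h | h | h
  · exact Or.inl h
  · exact Or.inr h
  · exfalso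
    have h1 : K.val = minCount D hbi hι x₀ hC₀ := K.val_eq_of_sub hA hK
    have h2 : K'.val = minCount D hbi hι x₀ hC₀ := K'.val_eq_of_sub hA hK'
    have h3 := D.count_add_count_le_of_disjoint h (fun L hL _ ↦ D.image_nonempty_of_mem_sepLeaves hL)
    have h4 : D.count (discLeaf F ι K.y ∪ discLeaf F ι K'.y) ≤ D.count A := D.count_mono (union_subset hK hK')
    have h5 : 1 ≤ D.count (discLeaf F ι K.y) := D.one_le_count_discLeaf hbi hι K.compact (K.sub.trans hΩ)
    have h6 : D.count (discLeaf F ι K.y) = D.count (discLeaf F ι K'.y) := by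
      rw [← CompactPattern.val, ← CompactPattern.val, h1, h2]
    rw [hA, ← h1, CompactPattern.val] at h4
    omega

end Chain

end StarData

end Literature.Topology.PlanarFoliations
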